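import Summits.BirchSwinnertonDyer.BirchSwinnertonDyer.Theorems.KolyvaginRoadThreeMethod2InductionOfLevelSystems
import Summits.BirchSwinnertonDyer.BirchSwinnertonDyer.Theorems.AdditiveKolyvaginRoadLevelSystems
import Summits.BirchSwinnertonDyer.BirchSwinnertonDyer.Theorems.AdditiveKolyvaginRoadEigen
import HarnessLib

/-!
# Route `AdditiveKolyvaginRoad`, crux `KolyvaginPrimitiveAdditive` (item stmt-BirchSwinnertonDyer-20132):
# S2-ENGINE at a GENERAL prime `p`, MODULO the engine-currency inputs — W. Zhang's induction above the bottom from a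
# `LevelKolyvaginSystemP`, (A1) and odd `p`-Selmer rank `≥ 3`
# (cell `pub/bsd-wall`, lead prover `bsd-wall-akr-p1` g3; `--supports stmt-BirchSwinnertonDyer-20132`, helper;
# p-generic port of zhang3-p1's `Theorems/KolyvaginRoadThreeMethod2InductionOfLevelSystems.lean` §3–§4)

WHY THIS FILE. Skeleton v7 of crux 20132 re-cuts v6's residual stub S2 (`stub_inductionGivenRankLoweringAdditive`,
W. Zhang's induction GIVEN (A1)) into S2-KS (`Nonempty (LevelKolyvaginSystemP …)`, OPEN at `p² ∣ N`), S2-LOC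
(`Nonempty (KolyvaginLocalPackageP …)`, the local–global package, E-side) and S2-ENGINE (the induction itself from the
two packages + (A1), PROVABLE). This file is the first layer of S2-ENGINE's proof: the tree's p-UNIFORM engine-of-KS
`ZhangTriangulation.exists_ne_zero_of_zhangInduction_on_of_kolyvaginSystem_finite_oddStart` (zhang3-p1; (A3)
DERIVED from Kolyvagin-system axioms at non-empty levels, parity CARRIED) instantiated on the p-generic canonical spaces
`SelQP` ∕ `SelRelQP` ∕ `baseLocusQP` of `AdditiveKolyvaginRoadLevelDefs` with `Good := ⊤` (no «good level»
relativisation at general `p`: Bertolini–Darmon admissibility has `Frob_q² ≠ 1` built in), reading a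
`LevelKolyvaginSystemP S` for (A2) `S.transport` and (A5) `S.baseCase`, `relaxationP_le` for (A4), and the parity ∕
`3 ≤ dim` at the bottom through akr-p1 g2's `finrank_selmer_eq_finrank_selQP_add` (odd `p`).

WHAT.
* §1 `LevelKolyvaginSystemP.exists_kolyvaginClass_ne_zero` — a non-zero BOTTOM class `κ m ∅` of a level system IS a
  witness of the crux's conclusion at the frame (realisation + `KolSupp` of a square-free product of Kolyvagin primes,
  zhang3-p1's `Method2.kolSupp_finsetProd` reused);
* §2 `inductionOfLevelSystemsP_of_engineInputs` — S2-ENGINE's conclusion from a `LevelKolyvaginSystemP`, (A1), the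
  parity and `3 ≤ dim`, MODULO the engine-currency inputs over ANY place-indexed apparatus
  `(P, Hv, loc, b, E, L, pl, plQ, Fv, Tv)`: membership dictionaries `hSel` ∕ `hSelRel`, base-locus vanishing `hB`,
  the Kolyvagin-system readings `hcE` ∕ `hcL` ∕ `hcT` ∕ `hfs` of `S.κ`, and (REC), (Cheb) ×2, (Supply), (Perf) ∕
  (Line) ∕ (Iso), `hpl`, `hLF` — the list the next two layers (dictionary layer, local–global layer) discharge in the
  model from `KolyvaginLocalPackageP` and McCallum's Cor. 3.2.

HONEST FRAMING: theorems only; 0 definitions, 0 named facts, 0 `sorry`; CONDITIONAL on every binder; closes nothing.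

References: [cite: WZhang2014, §9 proof of Thm. 9.1, Lemma 8.4, §8.1, Thm. 9.2] [cite: McCallumLMS1991, Prop. 3.1,
Lemma 5.3] [cite: GrossLMS1991, §3 (square-free products of Kolyvagin primes)].
-/

-- single-conjunct summit: `Summit.BirchSwinnertonDyer.BirchSwinnertonDyer.…` repeats the name by design
set_option linter.dupNamespace false

noncomputable section

open scoped Classical

namespace Summit.BirchSwinnertonDyer.BirchSwinnertonDyer.Theorems.AdditiveKoly

open WeierstrassCurve NumberField IsDedekindDomain
  Literature.NumberTheory.EllipticCurves Literature.NumberTheory.EllipticCurves.ModularForms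
  Literature.NumberTheory.GaloisRepresentations Module
open Summit.BirchSwinnertonDyer.Rank1Residual.X11b.Three.Koly

variable (W : WeierstrassCurve ℚ) (K : Type) [Field K] [NumberField K] (p : ℕ)
variable [W.IsElliptic] [W.IsGloballyMinimal] [NeZero (W.conductorNorm ℤ)] [Fact p.Prime]
  (Dt : ModularParametrizationData W (W.conductorNorm ℤ)) (β : ℤ) (ι : K →+* ℂ) (c : K ≃ₐ[ℚ] K)
  [Module (ZMod p) (Vp W K p)]

/-! ## §1 A non-zero bottom class of a level system is a crux witness -/

omit [W.IsElliptic] in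
/-- **A non-zero BOTTOM class of a level Kolyvagin system is a witness of the crux's conclusion at the frame**: by
`realisation`, `κ m ∅` is the Kolyvagin class mod `p` of some Kolyvagin–Heegner datum of conductor `∏ m`, which is a
square-free product of Kolyvagin primes (`Method2.kolSupp_finsetProd`). [cite: WZhang2014, §3.7 (3.21), §9] -/
theorem LevelKolyvaginSystemP.exists_kolyvaginClass_ne_zero (S : LevelKolyvaginSystemP W K p Dt β ι c)
    {m : Finset {ℓ // Zhang2014.IsKolyvaginPrime (W.conductorNorm ℤ) W K p ℓ}} (hm : S.κ m ∅ ≠ 0) :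
    ∃ (n : ℕ) (d : KolyvaginHeegnerData Dt β ι n),
      KolyvaginDescent.KolSupp (Zhang2014.IsKolyvaginPrime (W.conductorNorm ℤ) W K p) n ∧
        d.kolyvaginClass (Fact.out : p.Prime) 1 ≠ 0 := by
  obtain ⟨d, hd⟩ := S.realisation m
  exact ⟨_, d, Method2.kolSupp_finsetProd (fun ℓ h ↦ h.1) m, hd ▸ hm⟩

/-! ## §2 S2-ENGINE modulo the engine's level-independent inputs, general `p` -/

/-- **S2-ENGINE at a general prime, MODULO the engine-currency inputs.** At a frame (`K` imaginary quadratic, `p`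
odd): a `LevelKolyvaginSystemP S`, (A1) rank lowering for the canonical spaces `SelQP` (the body of the LANDED stub A1
of crux 20132), `dim_𝔽_p Sel_p(E/K)` odd and `≥ 3`, and — over ANY place-indexed apparatus
`(P, Hv, loc, b, E, L, pl, plQ, Fv, Tv)` — the ENGINE-CURRENCY readings: membership dictionaries for `SelQP` ∕
`SelRelQP n (baseLocusQP κ n)`, vanishing of the classes on `baseLocusQP`, the Kolyvagin-system readings of `S.κ` at
non-empty levels (signs `S.ε₀`), and (REC), (Cheb) ×2, (Supply), (Perf) ∕ (Line) ∕ (Iso), `hpl`, `hLF` ⟹ some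
Kolyvagin class of the frame is non-zero. Proof: zhang3-p1's engine with `Good := ⊤`, `Sel := SelQP`,
`SelRel := SelRelQP`, `B := baseLocusQP S.κ`, `m₁ := ∅`, (A2) := `S.transport`, (A5) := `S.baseCase`,
(A4) := `relaxationP_le`, started at `∅` (even, odd rank by `finrank_selmer_eq_finrank_selQP_add`, rank `≠ 1` by
`3 ≤ dim`); then §1. [cite: WZhang2014, §9 proof of Thm. 9.1, Lemma 8.4, §8.1] -/
theorem inductionOfLevelSystemsP_of_engineInputs (hp2 : p ≠ 2) (hK : IsImaginaryQuadratic K)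
    (S : LevelKolyvaginSystemP W K p Dt β ι c)
    {P : Type} [DecidableEq P] {Hv : P → Type} [∀ v, AddCommGroup (Hv v)] [∀ v, Module (ZMod p) (Hv v)]
    (E : Bool → Submodule (ZMod p) (Vp W K p)) (loc : (v : P) → Vp W K p →ₗ[ZMod p] Hv v)
    (b : (v : P) → Hv v →ₗ[ZMod p] Hv v →ₗ[ZMod p] ZMod p)
    (L : Finset (AdmQ W K p) → (v : P) → Submodule (ZMod p) (Hv v))
    (pl : {ℓ // Zhang2014.IsKolyvaginPrime (W.conductorNorm ℤ) W K p ℓ} → P)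
    (plQ : AdmQ W K p → P)
    (Fv Tv : (ℓ : {ℓ // Zhang2014.IsKolyvaginPrime (W.conductorNorm ℤ) W K p ℓ}) → Submodule (ZMod p) (Hv (pl ℓ)))
    -- membership dictionaries and base-locus vanishing, engine currency
    (hSel : ∀ (n : Finset (AdmQ W K p)) (s : Bool) (x : Vp W K p),
      x ∈ SelQP W K p c n s ↔ x ∈ E s ∧ ∀ v, loc v x ∈ L n v)
    (hSelRel : ∀ (n : Finset (AdmQ W K p)) (s : Bool) (x : Vp W K p),
      x ∈ SelRelQP W K p c n (baseLocusQP W K p S.κ n) s ↔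
        x ∈ E s ∧ ∀ v, v ∉ plQ '' baseLocusQP W K p S.κ n → loc v x ∈ L n v)
    (hB : ∀ n, ∀ q ∈ baseLocusQP W K p S.κ n, ∀ m, loc (plQ q) (S.κ m n) = 0)
    -- the local picture at Kolyvagin primes and global reciprocity
    (hpl : Function.Injective pl)
    (hLF : ∀ n ℓ, L n (pl ℓ) = Fv ℓ)
    (hisoL : ∀ n (v : P), ∀ x ∈ L n v, ∀ y ∈ L n v, b v x y = 0)
    (hisoT : ∀ ℓ, ∀ x ∈ Tv ℓ, ∀ y ∈ Tv ℓ, b (pl ℓ) x y = 0)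
    (hperf : ∀ ℓ (s : Bool), ∀ x ∈ E s, ∀ y ∈ E s, loc (pl ℓ) x ∈ Fv ℓ → loc (pl ℓ) x ≠ 0 →
      loc (pl ℓ) y ∈ Tv ℓ → loc (pl ℓ) y ≠ 0 → b (pl ℓ) (loc (pl ℓ) x) (loc (pl ℓ) y) ≠ 0)
    (hline : ∀ ℓ (s : Bool), ∃ e : Hv (pl ℓ), ∀ x ∈ E s, loc (pl ℓ) x ∈ Fv ℓ → ∃ a : ZMod p, loc (pl ℓ) x = a • e)
    (hrec : ∀ (x y : Vp W K p) (T : Finset P), (∀ v, v ∉ T → b v (loc v x) (loc v y) = 0) →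
      ∑ v ∈ T, b v (loc v x) (loc v y) = 0)
    -- Kolyvagin-system readings of the system's classes at non-empty levels
    (hcE : ∀ (n : Finset (AdmQ W K p)), n.Nonempty → ∀ m, S.κ m n ∈ E (S.ε₀ n ^^ Nat.bodd m.card))
    (hcL : ∀ (n : Finset (AdmQ W K p)), n.Nonempty → ∀ m (v : P), (∀ ℓ ∈ m, pl ℓ ≠ v) →
      loc v (S.κ m n) ∈ L n v)
    (hcT : ∀ (n : Finset (AdmQ W K p)), n.Nonempty → ∀ m, ∀ ℓ ∈ m, loc (pl ℓ) (S.κ m n) ∈ Tv ℓ)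
    (hfs : ∀ (n : Finset (AdmQ W K p)), n.Nonempty → ∀ m ℓ, ℓ ∉ m →
      (loc (pl ℓ) (S.κ (insert ℓ m) n) = 0 ↔ loc (pl ℓ) (S.κ m n) = 0))
    -- Čebotarev ×2 and Supply
    (hCheb1 : ∀ x : Vp W K p, x ≠ 0 → ∀ T : Finset {ℓ // Zhang2014.IsKolyvaginPrime (W.conductorNorm ℤ) W K p ℓ},
      ∃ ℓ, ℓ ∉ T ∧ loc (pl ℓ) x ≠ 0)
    (hCheb2 : ∀ (s : Bool), ∀ x ∈ E s, ∀ y ∈ E (!s), x ≠ 0 → y ≠ 0 →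
      ∀ T : Finset {ℓ // Zhang2014.IsKolyvaginPrime (W.conductorNorm ℤ) W K p ℓ},
      ∃ ℓ, ℓ ∉ T ∧ loc (pl ℓ) x ≠ 0 ∧ loc (pl ℓ) y ≠ 0)
    (hSupply : ∀ (n : Finset (AdmQ W K p)), n.Nonempty →
      ∀ (ℓ : {ℓ // Zhang2014.IsKolyvaginPrime (W.conductorNorm ℤ) W K p ℓ}) (T : Finset _), ℓ ∉ T →
      ∀ s : Bool, ∃ x ∈ E s, x ≠ 0 ∧
        (∀ v : P, v ≠ pl ℓ → (∀ ℓ' ∈ T, pl ℓ' ≠ v) → loc v x ∈ L n v) ∧ ∀ ℓ' ∈ T, loc (pl ℓ') x ∈ Tv ℓ')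
    -- (A1) at the frame (the landed stub A1's body), the parity and the rank ≥ 3
    (hA1 : ∀ (n : Finset (AdmQ W K p)) (μ : Bool) (x : Vp W K p),
      x ∈ SelQP W K p c n μ → x ≠ 0 →
      ∃ q : AdmQ W K p, q ∉ n ∧
        x ∉ SelQP W K p c (insert q n) μ ∧
        SelQP W K p c (insert q n) μ ≤ SelQP W K p c n μ ∧
        finrank (ZMod p) (SelQP W K p c (insert q n) μ) + 1 = finrank (ZMod p) (SelQP W K p c n μ) ∧
        SelQP W K p c (insert q n) (!μ) = SelQP W K p c n (!μ))
    (hodd : Odd (finrank (ZMod p)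
      (AddSubgroup.toZModSubmodule p (selmerGroup (W.baseChange K) ((p ^ 1 : ℕ) : ℤ)))))
    (h3 : 3 ≤ finrank (ZMod p)
      (AddSubgroup.toZModSubmodule p (selmerGroup (W.baseChange K) ((p ^ 1 : ℕ) : ℤ)))) :
    ∃ (n : ℕ) (d : KolyvaginHeegnerData Dt β ι n),
      KolyvaginDescent.KolSupp (Zhang2014.IsKolyvaginPrime (W.conductorNorm ℤ) W K p) n ∧
        d.kolyvaginClass (Fact.out : p.Prime) 1 ≠ 0 := by
  -- the parity and the rank at the bottom level, in canonical-space currency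
  have hcc : c * c = 1 := Method2.algEquiv_mul_self_eq_one K hK c
  rw [finrank_selmer_eq_finrank_selQP_add W K p hp2 hK c hcc] at hodd h3
  -- the engine's binders with `Good := ⊤`
  have hA1' : ∀ (n : Finset (AdmQ W K p)) (μ : Bool) (x : Vp W K p), True → x ∈ SelQP W K p c n μ → x ≠ 0 →
      ∃ q : AdmQ W K p, q ∉ n ∧ True ∧
        x ∉ SelQP W K p c (insert q n) μ ∧
        SelQP W K p c (insert q n) μ ≤ SelQP W K p c n μ ∧
        finrank (ZMod p) (SelQP W K p c (insert q n) μ) + 1 = finrank (ZMod p) (SelQP W K p c n μ) ∧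
        SelQP W K p c (insert q n) (!μ) = SelQP W K p c n (!μ) := by
    intro n μ x _ hx hx0
    obtain ⟨q, hqn, hxq, hle, hrk, hop⟩ := hA1 n μ x hx hx0
    exact ⟨q, hqn, trivial, hxq, hle, hrk, hop⟩
  have hA2' : ∀ (n : Finset (AdmQ W K p)) (q₁ q₂ : AdmQ W K p), True → True → True →
      q₁ ∉ n → q₂ ∉ insert q₁ n → q₂ ∉ baseLocusQP W K p S.κ (insert q₂ (insert q₁ n)) → ∃ m, S.κ m n ≠ 0 :=
    fun n q₁ q₂ _ _ _ ↦ S.transport n q₁ q₂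
  have hA4' : ∀ (n : Finset (AdmQ W K p)) (q : AdmQ W K p) (T : Set (AdmQ W K p)) (s : Bool), True → True →
      q ∉ n → q ∈ T → SelQP W K p c n s ≤ SelRelQP W K p c (insert q n) T s :=
    fun n q T s _ _ hqn hqT ↦ relaxationP_le W K p c n q T s hqn hqT
  have hA5' : ∀ (n : Finset (AdmQ W K p)), True → n.Nonempty → Even n.card →
      finrank (ZMod p) (SelQP W K p c n true) + finrank (ZMod p) (SelQP W K p c n false) = 1 → S.κ ∅ n ≠ 0 :=
    fun n _ hn he h1 ↦ S.baseCase n hn he h1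
  obtain ⟨m, hm⟩ :=
    ZhangTriangulation.exists_ne_zero_of_zhangInduction_on_of_kolyvaginSystem_finite_oddStart (fun _ ↦ True)
      (SelQP W K p c) (SelRelQP W K p c) (baseLocusQP W K p S.κ) S.κ ∅ E loc b L pl plQ Fv Tv S.ε₀
      (fun n _ ↦ hSel n) (fun n _ ↦ hSelRel n) hB hpl hLF hisoL hisoT hperf hline hrec (fun n _ ↦ hcE n)
      (fun n _ ↦ hcL n) (fun n _ ↦ hcT n) (fun n _ ↦ hfs n) hCheb1 hCheb2 (fun n _ ↦ hSupply n) hA1' hA2' hA4'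
      hA5' ∅ trivial (by simp) hodd (Or.inr (by omega))
  exact S.exists_kolyvaginClass_ne_zero W K p Dt β ι c hm

end Summit.BirchSwinnertonDyer.BirchSwinnertonDyer.Theorems.AdditiveKoly

end
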